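import Summits.BirchSwinnertonDyer.BirchSwinnertonDyer.Theses.SmallImageMuTransfer
import Summits.BirchSwinnertonDyer.Rank1Residual.X10.CoreTheoremAOddPrimeHolds
import Summits.BirchSwinnertonDyer.Rank1Residual.X9.SurjKatoCertificateRoute
import Literature.NumberTheory.EllipticCurves.Kato2004.ZetaSideInputs
import HarnessLib

/-!
# The crux `MuTransfer` (stmt-BirchSwinnertonDyer-19629) BY NAME modulo the ZETA SIDE of Kato's package
# and the verbatim Thm. 17.4 — the Euler-system DIVISIBILITY half of F1 leaves the non-surjective branch

Cell `bsd-smallim` (rung K6 of `BirchSwinnertonDyer`, class X9), seat `bsd-line-k6-p2` (D-0154 KEY (146)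
row 9; line `f1_fine` of `Cruxes/MuTransfer`).  HONEST FRAMING: proves no case of BSD and closes no item —
19629 stays OPEN by design; every theorem here is CONDITIONAL on named published facts (the gate records
`conditional-result`).  PARTITION (D-0054): X9 (A4) — types-the-object-of; closes NONE; bears_on: K6
(route-BirchSwinnertonDyer-SmallImageMuTransfer item 19629; shared with route PrintX9).

## What is new

Of record (k6-c2 g6, p482919): `Theorems.smallImageMuTransfer_MuTransfer_of_fine : F1 → MuTransfer`, F1 =
`Kato2004.exists_divisibilityInputs_fineQuotient_zeta` = Kato's WHOLE §17.13 package (Thm. 12.4 (1),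
12.5 (2)–(4), 12.6, 16.6 (2), 17.4 (2), Prop. 17.11, (17.13.1)–(17.13.4), p. 280) with the fine quotient and
the span clause.  Reading the two branches of that proof against the package's 30 fields:

* the NON-SURJECTIVE branch (CM included; the cell's Theorem A core `X10.coreTheoremAOddPrime_holds` fed by
  `X10.mu_eq_zero_of_coreOddPrime`) consumes ONLY the zeta side at `(p)` — `loc, toX, exact_P, col,
  col_injective, Z`, the span clause, the fine quotient and the first half of `image_zeta_localized` at
  `𝔭 = (p)` — now the Literature sub-package `Kato2004.ZetaSideInputs` / fact
  `Kato2004.exists_zetaSideInputs` (ZS; F1 ⟹ ZS and F1′ ⟹ ZS by forgetting fields,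
  `Kato2004.exists_zetaSideInputs_of_fineQuotient_zeta` / `…_of_zetaLine`): theorem
  `smallImageMuTransfer_mu_eq_zero_of_nonsurj_of_zetaSide` re-runs the registered composition over ZS;
* the SURJECTIVE branch consumes only Kato's Thm. 17.4 (1)(3) at the datum — the tree's VERBATIM named
  predicate `kato_divisibility W p` (file `PAdicBSD`), here a by-name binder `hKato` (as in x10 g40's
  `smallImageMuTransfer_MuTransfer_of_kato`) instead of being derived from F1's field `integral`:
  `smallImageMuTransfer_mu_eq_zero_of_surj_of_kato` (principal characteristic ideal by
  `charIdeal_isPrincipal_holds`; no Burungale–Castella–Skinner).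

Hence **`smallImageMuTransfer_MuTransfer_of_zetaSide_of_kato : ZS → (∀ data, kato_divisibility) → MuTransfer`**
— the parent item BY NAME on a hypothesis IMPLIED by F1 (F1 ⟹ ZS is
`Kato2004.exists_zetaSideInputs_of_fineQuotient_zeta`; F1 ⟹ `kato_divisibility` at every datum is k6-c2 g6's
`smallImageMuTransfer_kato_divisibility_of_fine`, p482919; the one-line composition re-deriving p482919's
statement is recorded in the line's workfile `Cruxes/MuTransfer/Lines/f1_fine.lean`, not here, to keep this
file's import cone free of other route-dependent Theorems files), i.e. a formally STRONGER conditional theorem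
whose two inputs are each closer to print: ZS = the CONSTRUCTION of the zeta elements with the explicit reciprocity
law, the Coleman map and Poitou–Tate at one spot (Kato §§2–8, Thm. 12.5 (1), 12.6, Ex. 13.3, 16.6 (2), 17.5,
Prop. 17.11, (17.13.1)/(17.13.3), (14.9.3)); `kato_divisibility` = Thm. 17.4 verbatim.  Kato's Euler-system
DIVISIBILITY theorems (Thm. 12.4, 12.5 (2)–(4), 13.4, (17.13.2), (17.13.4)) are OUT of the cone of the
non-surjective branch — the branch that is the NEW content of the crux.  For the planner (not this seat's
call): the single registered stub `stub_inputs : F1` of line `f1_fine` may be re-keyed as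
`stub_zetaSide : ZS` + `stub_kato : ∀ data, kato_divisibility` without touching the composition.

References: K. Kato, Astérisque 295 (2004) Thm. 12.5 (1), Thm. 12.6, Ex. 13.3, (14.9.3), Thm. 16.6 (2), Thm.
17.4, 17.5, Prop. 17.11, §17.13 [Kato2004Asterisque]; R. Greenberg, V. Vatsal, Invent. Math. 142 (2000) Prop.
3.7 [GreenbergVatsal2000]; J.-P. Serre, *Abelian ℓ-adic representations* IV-23 [SerreAbelianLadic1968];
L. Washington, *Cyclotomic Fields* §13.2 [Washington1997]; HOME/koly/MU-TRANSFER-PROOF.md Theorem A / Cor. B.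
-/

-- the summit and its single problem are both named `BirchSwinnertonDyer` (registry layout D-0017)
set_option linter.dupNamespace false
set_option autoImplicit false

noncomputable section

open scoped Classical MatrixGroups ModularForm NumberField
open CongruenceSubgroup WeierstrassCurve Field IsDedekindDomain
open Literature.NumberTheory.GaloisRepresentations
open Literature.NumberTheory.EllipticCurves Literature.NumberTheory.EllipticCurves.ModularForms
open Literature.NumberTheory.EllipticCurves.Kato2004
open Literature.NumberTheory.EllipticCurves.Kato2004.EulerSystemValues
open Literature.NumberTheory.EllipticCurves.Rank1Residual
open Summit.BirchSwinnertonDyer.BirchSwinnertonDyer.Rank1Residual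
open Summit.BirchSwinnertonDyer.BirchSwinnertonDyer.Theses.SmallImageMuTransfer
open Summit.BirchSwinnertonDyer.Rank1Residual (hasSurjectiveModNGaloisRep_pow_of_surj
  hasUnitContent_of_mem_span_singleton)
open Summit.BirchSwinnertonDyer.Rank1Residual.X10 (coreTheoremAOddPrime_holds)

namespace Summit.BirchSwinnertonDyer.BirchSwinnertonDyer.Theorems

/-! ## The non-surjective branch over the zeta-side package -/

/-- **`μ(X(E/ℚ_∞)) = 0` at every odd good ordinary prime with `E[p]` irreducible and `ρ̄` NOT surjective,
given one unit coefficient of `L_p(f, α)` — modulo the ZETA SIDE of Kato's package ALONE** (ZS =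
`Kato2004.exists_zetaSideInputs`).  The registered composition `X10.mu_eq_zero_of_coreOddPrime` re-run over
the sub-package: GV Prop. 3.7 gives `ι G₁ = L_p` and the certificate `G₁ ∉ (p)`; the `(p)`-clause and the
span clause give a GENUINE Euler-system class outside `p𝐇¹` (`ZetaSideInputs.exists_isEulerSystemClass_notMem`);
the cell's Theorem A core (`X10.coreTheoremAOddPrime_holds`, unconditional) kills `Sel₀(ℚ_∞, E[p^∞])[p]`
by a power of `T`, so `X₀/pX₀` is finite and `length_(p) X₀ = 0`; the bookkeeping
`ZetaSideInputs.mu_eq_zero_of_lengthAt_fine_eq_zero` (exactness at `P`, injective Coleman map, fine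
quotient) gives `D.mu = 0`.  CM or not; conditional on ZS only; nothing asserted.
[cite: Kato2004Asterisque, Thm. 12.6 (p. 222), Ex. 13.3 (p. 225), (14.9.3) (p. 240), Thm. 16.6 (2) (p. 271), Prop. 17.11 (p. 277) and §17.13 (pp. 279–280)]
[cite: GreenbergVatsal2000, Prop. 3.7] -/
theorem smallImageMuTransfer_mu_eq_zero_of_nonsurj_of_zetaSide (hZS : exists_zetaSideInputs) :
    ∀ (W : WeierstrassCurve ℚ) [W.IsElliptic] [W.IsGloballyMinimal] (p : ℕ) [Fact p.Prime]
      {N : ℕ} [NeZero N] (f : CuspForm (Gamma0 N) 2),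
      p ≠ 2 → W.HasGoodReductionAtPrime p → ¬ (p : ℤ) ∣ W.frobeniusTrace p →
      W.HasIrreducibleModPGaloisRep p → ¬ W.HasSurjectiveModNGaloisRep p → IsNewformOf W f →
      (∃ n : ℕ, ‖PowerSeries.coeff n (padicLFunction f (unitRoot W p : ℚ_[p]))‖ = 1) →
      ∀ (κ : ZpExtension ℚ p) (γ : absoluteGaloisGroup ℚ),
        κ.IsCyclotomic → κ.IsTopGenerator γ → IsCyclotomicVariable p γ →
        ∀ D : W.SelmerDualData κ γ, D.mu = 0 := by
  intro W _ _ p _ N _ f hp2 hgood hap hirr hnsurj hf hcert κ γ hκ hγ hγ' D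
  haveI : ContinuousSMul ℤ_[p] (W.tateModule p) := TateModule.continuousSMul_padicInt
  haveI : Module.Free ℤ_[p] (W.tateModule p) := W.module_free_tateModule_holds p
  haveI : Module.Finite ℤ_[p] (W.tateModule p) := W.module_finite_tateModule_holds p
  have hord : IsOrdinaryAt W p := ⟨hgood, hap⟩
  -- the pinned modules: `𝐇¹_Γ(T_pW)` and the dual fine Selmer group `X₀(E/ℚ_∞)`
  obtain ⟨I⟩ := nonempty_iwasawaH1Data_holds W p κ γ hκ hγ
  obtain ⟨Y⟩ := W.nonempty_fineSelmerDualData κ hγ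
  -- `X(E/ℚ_∞)` is finitely generated over `Λ` for the cyclotomic `κ` (tree theorem)
  haveI : Module.Finite (IwasawaAlgebra p) D.X :=
    WeierstrassCurve.SelmerDualData.module_finite_of_isCyclotomic W κ hκ D hγ
  -- the zeta-side package
  obtain ⟨K⟩ := hZS W p f κ γ hp2 hord hκ hγ hγ' hf I D Y
  haveI : Module.Finite (IwasawaAlgebra p) Y.X := Module.Finite.of_surjective K.π K.π_surjective
  -- `L_p ∈ Λ` (GV Prop. 3.7) and the certificate: `G₁ ∉ (p)`
  obtain ⟨G₁, hG₁⟩ := exists_iwasawaToPowerSeries_eq_padicLFunction hp2 hord hf hirr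
  have hμL : G₁ ∉ IwasawaAlgebra.augIdealP p := not_mem_augIdealP_of_norm_coeff_eq_one hG₁ hcert
  -- §6 (i) with the span clause: some GENUINE Euler-system class is not divisible by `p`
  obtain ⟨s, hs, hsp⟩ := K.exists_isEulerSystemClass_notMem hirr hG₁ hμL
  -- the core of Theorem A (unconditional, odd prime): a power of `T` kills the `E[p]`-lifts of `Sel₀`
  obtain ⟨J, hJ⟩ := coreTheoremAOddPrime_holds W p κ γ I hp2 hgood hap hirr hnsurj hκ hγ ⟨s, hs, hsp⟩
  haveI : Finite (Y.X ⧸ (IwasawaAlgebra.augIdealP p • (⊤ : Submodule (IwasawaAlgebra p) Y.X))) :=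
    Y.finite_quotient_augIdealP_of_finite_pTorsion
      (W.finite_fineSelmerInfty_pTorsion_of_forall_iterate_eq_zero κ hγ hJ)
  -- bookkeeping at `𝔭 = (p)`: `length X₀_𝔭 = 0 ⟹ μ(X) = 0`
  let 𝔭 : PrimeSpectrum (IwasawaAlgebra p) :=
    ⟨IwasawaAlgebra.augIdealP p, IwasawaAlgebra.isPrime_augIdealP_holds p⟩
  have hY0 : Module.lengthAt (IwasawaAlgebra p) Y.X 𝔭 = 0 :=
    Summit.BirchSwinnertonDyer.BirchSwinnertonDyer.Rank1Residual.KatoMuSkeleton.lengthAt_eq_zero_of_finite_quotient_p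
      (M := Y.X) 𝔭 rfl
  exact K.mu_eq_zero_of_lengthAt_fine_eq_zero hirr hG₁ hcert 𝔭 rfl hY0

/-! ## The surjective branch over Kato's Thm. 17.4 verbatim -/

/-- **`μ(X(E/ℚ_∞)) = 0` on the SURJECTIVE good-ordinary cell at `p ≥ 5` from Kato's Thm. 17.4 BY NAME
(the tree's predicate `kato_divisibility W p`, every cyclotomic datum and newform) and one unit coefficient of
`L_p(f, α)`** — the surjective branch of p482919 with the Thm. 17.4 binder taken verbatim instead of being
derived from F1.  Clause (3) under `ρ̄_{E,p^m}` onto for all `m` (Serre IV-23 from `surj(p)` and `p ≥ 5`,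
`hasSurjectiveModNGaloisRep_pow_of_surj`) gives `g₁ ∈ char_Λ X` with `ι g₁ = L_p(f, α)`; `char_Λ X = (g₀)`
is principal (`charIdeal_isPrincipal_holds`); the certificate makes `μ(g₁) = 0`, hence `μ(g₀) = 0`
(`hasUnitContent_of_mem_span_singleton`), i.e. `μ(X) = 0` (`GreenbergVatsal2000.mu_eq_zero_iff_hasUnitContent`,
`X` torsion by clause (1)).  Conditional on the binder; nothing asserted.
[cite: Kato2004Asterisque, Thm. 12.5 (4) (p. 222) and Thm. 17.4 (1)(3) (p. 273)]
[cite: SerreAbelianLadic1968, Ch. IV §3.4 Lemma 3 (IV-23)] [cite: GreenbergVatsal2000, p. 2, (1)–(2)]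
[cite: Washington1997, §13.2] -/
theorem smallImageMuTransfer_mu_eq_zero_of_surj_of_kato
    (hKato : ∀ (W : WeierstrassCurve ℚ) [W.IsElliptic] [W.IsGloballyMinimal] (p : ℕ) [Fact p.Prime]
      (κ : ZpExtension ℚ p) (γ : Field.absoluteGaloisGroup ℚ) (N : ℕ) [NeZero N]
      (f : CuspForm (Gamma0 N) 2), kato_divisibility W p (κ := κ) (γ := γ) (f := f))
    (W : WeierstrassCurve ℚ) [W.IsElliptic] [W.IsGloballyMinimal] (p : ℕ) [Fact p.Prime] (hp : 5 ≤ p)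
    (hgood : W.HasGoodReductionAtPrime p) (hap : ¬ (p : ℤ) ∣ W.frobeniusTrace p)
    (hsurj : W.HasSurjectiveModNGaloisRep p) {N : ℕ} [NeZero N] (f : CuspForm (Gamma0 N) 2)
    (hf : IsNewformOf W f)
    (hcert : ∃ n : ℕ, ‖PowerSeries.coeff n (padicLFunction f (unitRoot W p : ℚ_[p]))‖ = 1)
    (κ : ZpExtension ℚ p) (γ : absoluteGaloisGroup ℚ) (hκ : κ.IsCyclotomic)
    (hγ : κ.IsTopGenerator γ) (hγ' : IsCyclotomicVariable p γ) (D : W.SelmerDualData κ γ) :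
    D.mu = 0 := by
  have hp2 : p ≠ 2 := by omega
  haveI : Module.Finite (IwasawaAlgebra p) D.X := D.module_finite_holds hγ
  -- Kato (1) and (3) at the datum, by name
  obtain ⟨hX, -, h3⟩ := hKato W p κ γ N f hp2 ⟨hgood, hap⟩ hκ hγ hγ' hf D
  obtain ⟨g₁, hg₁, hιg₁⟩ := h3 (hasSurjectiveModNGaloisRep_pow_of_surj hp hsurj)
  -- the characteristic ideal is principal (Λ is a UFD)
  obtain ⟨g₀, hg₀⟩ := (charIdeal_isPrincipal_holds p D.X).principal
  have hchar : D.charIdeal = Ideal.span {g₀} := hg₀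
  have hg₁u : GreenbergVatsal2000.HasUnitContent g₁ := hasUnitContent_of_map_eq g₁ _ hιg₁ hcert
  have hg₀u : GreenbergVatsal2000.HasUnitContent g₀ :=
    hasUnitContent_of_mem_span_singleton (hchar ▸ hg₁) hg₁u
  exact (GreenbergVatsal2000.mu_eq_zero_iff_hasUnitContent D hX hchar).mpr hg₀u

/-! ## The parent item by name, modulo the zeta side and Thm. 17.4 -/

/-- **The parent crux `MuTransfer` (stmt-BirchSwinnertonDyer-19629), literally the route decl, modulo the
ZETA SIDE of Kato's package (ZS = `Kato2004.exists_zetaSideInputs`) and Kato's Thm. 17.4 BY NAME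
(`kato_divisibility`).**  Excluded middle on `surj(p)`: `smallImageMuTransfer_mu_eq_zero_of_surj_of_kato` /
`smallImageMuTransfer_mu_eq_zero_of_nonsurj_of_zetaSide`.  The hypothesis is IMPLIED by F1 (`Kato2004.exists_zetaSideInputs_of_fineQuotient_zeta`
and p482919's `smallImageMuTransfer_kato_divisibility_of_fine`), so this is p482919's theorem with a weaker
hypothesis, each conjunct closer to print; Kato's Euler-system divisibility theorems are out of the cone of the
non-surjective branch.  Conditional; the item stays open until both binders are theorems; BSD not advanced.
[cite: Kato2004Asterisque, Thm. 12.6 (p. 222), Thm. 16.6 (2) (p. 271), Thm. 17.4 (p. 273), Prop. 17.11 (p. 277) and §17.13 (pp. 279–280)]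
[cite: GreenbergVatsal2000, Prop. 3.7] -/
theorem smallImageMuTransfer_MuTransfer_of_zetaSide_of_kato (hZS : exists_zetaSideInputs)
    (hKato : ∀ (W : WeierstrassCurve ℚ) [W.IsElliptic] [W.IsGloballyMinimal] (p : ℕ) [Fact p.Prime]
      (κ : ZpExtension ℚ p) (γ : Field.absoluteGaloisGroup ℚ) (N : ℕ) [NeZero N]
      (f : CuspForm (Gamma0 N) 2), kato_divisibility W p (κ := κ) (γ := γ) (f := f)) :
    Summit.BirchSwinnertonDyer.BirchSwinnertonDyer.Theses.SmallImageMuTransfer.MuTransfer := by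
  unfold Summit.BirchSwinnertonDyer.BirchSwinnertonDyer.Theses.SmallImageMuTransfer.MuTransfer
    Summit.BirchSwinnertonDyer.BirchSwinnertonDyer.Rank1Residual.KatoMuTransfer
  intro W _ _ p _ N _ f hp hgood hap hirr hf hcert κ γ hκ hγ hγ' D
  by_cases hsurj : W.HasSurjectiveModNGaloisRep p
  · exact smallImageMuTransfer_mu_eq_zero_of_surj_of_kato hKato W p hp hgood hap hsurj f hf hcert κ γ
      hκ hγ hγ' D
  · exact smallImageMuTransfer_mu_eq_zero_of_nonsurj_of_zetaSide hZS W p f (by omega) hgood hap hirr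
      hsurj hf hcert κ γ hκ hγ hγ' D

/-- **The same statement under the tree's name `Rank1Residual.KatoMuTransfer`** (head constant of item 19629
and of `Theses.PrintX9.MuTransfer`), modulo ZS and Thm. 17.4 by name.
[cite: Kato2004Asterisque, Thm. 12.6 (p. 222), Thm. 17.4 (p. 273) and §17.13 (pp. 279–280)] -/
theorem smallImageMuTransfer_katoMuTransfer_of_zetaSide_of_kato (hZS : exists_zetaSideInputs)
    (hKato : ∀ (W : WeierstrassCurve ℚ) [W.IsElliptic] [W.IsGloballyMinimal] (p : ℕ) [Fact p.Prime]
      (κ : ZpExtension ℚ p) (γ : Field.absoluteGaloisGroup ℚ) (N : ℕ) [NeZero N]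
      (f : CuspForm (Gamma0 N) 2), kato_divisibility W p (κ := κ) (γ := γ) (f := f)) :
    Summit.BirchSwinnertonDyer.BirchSwinnertonDyer.Rank1Residual.KatoMuTransfer :=
  smallImageMuTransfer_MuTransfer_of_zetaSide_of_kato hZS hKato

end Summit.BirchSwinnertonDyer.BirchSwinnertonDyer.Theorems

end
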